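import Summits.NavierStokesRegularity.NavierStokesRegularity.Theses.SqueezeCycle
import Literature.Analysis.FluidPDE.NSKatoToClayHolds
import Literature.Analysis.FluidPDE.NSCriticalClosureBesovKatoClass
import Literature.Analysis.FluidPDE.NSLocalClassicalProofs
import Literature.Analysis.FluidPDE.KatoLerayHopf
import Literature.Analysis.FluidPDE.RusinSverakKatoBoundHolds
import Literature.Analysis.FluidPDE.NSWeakStrongUniquenessHolds
import Literature.Analysis.FluidPDE.NSLerayExistenceR3Holds
import Literature.Analysis.FluidPDE.KatoFarFieldBound
import Literature.Analysis.FluidPDE.LerayLocalRegularH1Proofs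
import Literature.Analysis.FluidPDE.KatoMaximalTimeSingular
import Literature.Analysis.FluidPDE.NSCriticalClosureBesovBounded
import Literature.Analysis.FluidPDE.WeakSolutionWeakContinuity
import Literature.Analysis.FluidPDE.MildL3SmoothHolds
import Literature.Analysis.FluidPDE.KatoL3Uniqueness
import Literature.Analysis.FluidPDE.TaoLocalisationHolds
import HarnessLib

/-!
# `NoBlowupToClay` (item stmt-NavierStokesRegularity-0055): no blow-up ⇒ Clay (A)

Summits-side theorem file for the shared support item stmt-NavierStokesRegularity-0055 of route
`SqueezeCycle` (decl `Summit.NavierStokesRegularity.NavierStokesRegularity.Theses.SqueezeCycle.NoBlowupToClay`):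
if every classical solution of the unforced Navier–Stokes system on `ℝ³ × [0, T)` which is a
Leray–Hopf weak solution from its rapidly decaying datum extends smoothly past `T`, then Clay (A)
(`NavierStokesRegularity`) holds. Every analytic input is a **theorem** of the tree (no named fact
is assumed). Proof, for `ν > 0` and a smooth, divergence-free, rapidly decaying datum `u₀`:

1. Local theory: a classical Leray–Hopf solution `(v, q)` from `u₀` on some `[0, T₀)`
   (`local_classical_lerayHopf_holds`); it is a Kato `C_t L³` solution
   (`isKatoSolutionOn_of_classical`), so `u₀ ∈ L² ∩ L³` is weakly divergence free and Kato's
   maximal time `T_max = katoMaximalTime ν u₀ ≥ T₀` is positive.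
2. If `T_max = ∞`, `u₀` has a global Kato solution (`hasGlobalKatoSolution_of_katoMaximalTime_eq_top`,
   `kato_unique_holds`) and the proved fact `clay_solution_of_hasGlobalKatoSolution_holds`
   (von Wahl / Lemarié-Rieusset 2016, Prop. 12.3: `C_t L³` is a regularity class) gives the Clay
   solution.
3. If `T_max = T < ∞`: the maximal Kato solution `κ` on `[0, T)`
   (`exists_isKatoSolutionOn_katoMaximalTime`) has a classical representative `(w, ϖ)` on `(0, T)`
   (`mild_L3_smooth_holds`), which agrees with `v` on `(0, T₀)` (`kato_unique_holds` and continuity)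
   and glues with it (`IsClassicalNSSolutionOn.glue`) to a classical solution `(U, P)` on `[0, T)`
   with `U 0 = u₀`, `U(t) = κ(t)` a.e. for every `t`.
4. Kato's smoothing bound `|κ| ≤ C/√t` a.e. on `(0, S) × ℝ³`, `S < T`
   (`kato_solution_le_div_sqrt_holds`), passes to every point for the continuous `U`; hence `κ`
   is a Leray–Hopf weak solution on every `[0, S']`, `S' < T`
   (`IsKatoSolutionOn.isLerayHopfOn_of_memLp_two`, ESS 2003 Rem. 7.5), in Serrin's class
   `L^∞(0, S'; L^∞)` (near `t = 0` by the bound of `v` on `[0, T₀/2]`, Tao 2013 Cor. 11.1,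
   `exists_forall_norm_le_of_tao2011`). Weak–strong uniqueness (`weak_strong_uniqueness_holds`)
   identifies `κ` — hence `U` — slice-wise a.e. on `(0, T)` with Leray's global weak solution
   `u_L` from `u₀` (`leray_existence_R3_holds`).
5. The velocity `Ũ` equal to `U` on `[0, T)` and to `u_L` from `T` on is classical on `[0, T)` and,
   being a.e. equal at every time of `[0, T]` to `u_L` (reset to `u₀` at `t = 0`), a Leray–Hopf
   weak solution on `[0, T]` from `u₀` (`IsLerayHopfOn.congr_ae_slices`). By the hypothesis it
   extends to a classical solution `W` on some `[0, T')`, `T' > T`.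
6. But `Ũ` is a Kato solution on `[0, T)` with maximal lifespan, so it has a singular point
   `(T, x₀)`: `Ũ ∉ L^∞(Q_r(T, x₀))` for all small `r` (`lemarieRieusset_singular_point_of_blowup_holds`,
   Lemarié-Rieusset 2016 Thm. 15.1 (C)); whereas `W = Ũ` on `Q_r(T, x₀)` and `W` is continuous on
   the compact `[0, (T+T')/2] × B̄₁(x₀)` — contradiction.

References: J. Leray, Acta Math. 63 (1934); T. Kato, Math. Z. 187 (1984), Thms. 1, 4;
P. G. Lemarié-Rieusset, *The Navier–Stokes Problem in the 21st Century* (2016), Thm. 15.1, Prop. 12.3;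
L. Escauriaza, G. Seregin, V. Šverák, Russ. Math. Surveys 58 (2003), Rem. 7.5; J. Serrin (1963),
G. Prodi (1959); T. Tao, Anal. PDE 6 (2013), Cor. 11.1.
-/

noncomputable section

open MeasureTheory TopologicalSpace Set Function Filter Metric
open _root_.Topology
open scoped ENNReal NNReal RealInnerProductSpace
open Literature.Analysis.FluidPDE

namespace Summit.NavierStokesRegularity.NavierStokesRegularity.Theorems

section UpdateZero

variable {E : Type*} [NormedAddCommGroup E] [InnerProductSpace ℝ E] [FiniteDimensional ℝ E]
  [MeasurableSpace E] [BorelSpace E]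

/-- **Resetting the junk initial slice of a Leray–Hopf solution.** The clauses of
`IsLerayHopfOn T ν 0 u₀ u` see the slice `u 0` only through `u 0 ∈ L²` and the energy inequality
at `t = 0` (trivial for the datum itself): replacing `u 0` by the datum `u₀ ∈ L²` gives again a
Leray–Hopf weak solution from `u₀` (Galdi 2000, Def. 2.1: the datum enters only through the weak
formulation and the limits `t → 0⁺`). [folklore] -/
theorem isLerayHopfOn_update_zero {T ν : ℝ} {u₀ : E → E} {u : ℝ → E → E}
    (hu : IsLerayHopfOn T ν 0 u₀ u) (hu₀ : MemLp u₀ 2 volume) :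
    IsLerayHopfOn T ν 0 u₀ (Function.update u 0 u₀) := by
  set v : ℝ → E → E := Function.update u 0 u₀ with hv
  have hvt : ∀ t : ℝ, t ≠ 0 → v t = u t := fun t ht => Function.update_of_ne ht _ _
  have hv0 : v 0 = u₀ := Function.update_self _ _ _
  have hIoo : ∀ᵐ t ∂(volume.restrict (Ioo (0 : ℝ) T)), v t = u t := by
    filter_upwards [ae_restrict_mem measurableSet_Ioo] with t ht
    exact hvt t ht.1.ne'
  obtain ⟨G, hG, hGint, h0, hs⟩ := hu.weakGrad_energy
  refine
    { weak := hu.weak.congr_ae_slice hIoo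
      energy_bound := ?_
      memLp := fun t ht => ?_
      weakGrad_energy := ⟨G, ?_, hGint, fun t ht => ?_, ?_⟩
      weak_continuous := fun w hw => ?_
      strong_initial := ?_ }
  · obtain ⟨C, hC⟩ := hu.energy_bound
    refine ⟨C, ?_⟩
    filter_upwards [hC, hIoo] with t ht hvu
    rwa [hvu]
  · rcases eq_or_ne t 0 with rfl | ht0
    · rw [hv0]; exact hu₀
    · rw [hvt t ht0]; exact hu.memLp t ht
  · filter_upwards [hG, hIoo] with t ht hvu
    rwa [hvu]
  · rcases eq_or_ne t 0 with rfl | ht0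
    · simp only [hv0, Ioo_self, Measure.restrict_empty, lintegral_zero_measure,
        ENNReal.toReal_zero, mul_zero, add_zero, Pi.zero_apply, inner_zero_left, integral_zero,
        intervalIntegral.integral_zero, le_refl]
    · have h1 := h0 t ht
      simp only [Pi.zero_apply, inner_zero_left, integral_zero, intervalIntegral.integral_zero,
        add_zero] at h1 ⊢
      rwa [hvt t ht0]
  · filter_upwards [hs, ae_restrict_mem measurableSet_Ioo] with s hs' hsI
    intro t ht
    have ht0 : t ≠ 0 := (hsI.1.trans_le ht.1).ne'
    have h1 := hs' t ht
    simp only [Pi.zero_apply, inner_zero_left, integral_zero, intervalIntegral.integral_zero,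
      add_zero] at h1 ⊢
    rwa [hvt t ht0, hvt s hsI.1.ne']
  · obtain ⟨hc, ht⟩ := hu.weak_continuous w hw
    refine ⟨hc.congr fun t ht' => ?_, ht.congr' ?_⟩
    · simp only [hvt t ht'.1.ne']
    · filter_upwards [self_mem_nhdsWithin] with t ht'
      simp only [hvt t (ne_of_gt ht')]
  · refine hu.strong_initial.congr' ?_
    filter_upwards [self_mem_nhdsWithin] with t ht'
    simp only [hvt t (ne_of_gt ht')]

end UpdateZero

/-- **An a.e. inequality between continuous functions on an open space–time set holds
everywhere on it** (an open set of measure zero is empty; Lebesgue measure on `ℝ × ℝ³` charges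
open sets). [folklore] -/
theorem forall_le_of_ae_restrict_le_of_continuousOn
    {O : Set (ℝ × EuclideanSpace ℝ (Fin 3))} (hO : IsOpen O) {f g : ℝ × EuclideanSpace ℝ (Fin 3) → ℝ}
    (hf : ContinuousOn f O) (hg : ContinuousOn g O)
    (h : ∀ᵐ z ∂(volume.restrict O), f z ≤ g z) : ∀ z ∈ O, f z ≤ g z := by
  have hopen : IsOpen (O ∩ (fun z => (g z, f z)) ⁻¹' {p : ℝ × ℝ | p.1 < p.2}) :=
    (hg.prodMk hf).isOpen_inter_preimage hO (isOpen_lt continuous_fst continuous_snd)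
  have hnull : volume (O ∩ (fun z => (g z, f z)) ⁻¹' {p : ℝ × ℝ | p.1 < p.2}) = 0 := by
    rw [ae_iff, Measure.restrict_apply' hO.measurableSet] at h
    rw [inter_comm]
    simpa only [not_le, preimage_setOf_eq] using h
  have hempty := (hopen.measure_eq_zero_iff volume).1 hnull
  intro z hz
  by_contra hlt
  have hmem : z ∈ O ∩ (fun z => (g z, f z)) ⁻¹' {p : ℝ × ℝ | p.1 < p.2} := ⟨hz, not_le.1 hlt⟩
  rw [hempty] at hmem
  exact hmem

/-- **The blow-up alternative for the Kato solution of a Clay datum, given no blow-up of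
classical Leray–Hopf solutions.** Under the no-blow-up hypothesis of `NoBlowupToClay`, the Kato
maximal time of a smooth, divergence-free, rapidly decaying datum is infinite (steps 3–6 of the
module docstring: a finite maximal time `T` carries a classical Leray–Hopf solution on `[0, T)`
from `u₀`, Leray–Hopf up to `T` through Leray's weak solution, whose classical continuation past
`T` is bounded near the singular point `(T, x₀)` of Lemarié-Rieusset's Thm. 15.1 (C) — absurd).
[cite: LemarieRieusset2016, Thm. 15.1 (C)] -/
theorem katoMaximalTime_eq_top_of_noBlowup
    (hNB : ∀ (ν T : ℝ), 0 < ν → 0 < T →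
      ∀ (u : ℝ → EuclideanSpace ℝ (Fin 3) → EuclideanSpace ℝ (Fin 3))
        (p : ℝ → EuclideanSpace ℝ (Fin 3) → ℝ),
        IsClassicalNSSolutionOn (Set.Ico 0 T) ν 0 u p → IsLerayHopfOn T ν 0 (u 0) u →
          HasRapidSpatialDecay (u 0) → HasSmoothExtensionPast ν 0 u T)
    {ν : ℝ} (hν : 0 < ν) {u₀ : EuclideanSpace ℝ (Fin 3) → EuclideanSpace ℝ (Fin 3)}
    (hsm : ContDiff ℝ (⊤ : ℕ∞) u₀) (hdiv : NSWave0.IsDivFree u₀) (hdec : HasRapidSpatialDecay u₀) :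
    katoMaximalTime ν u₀ = ⊤ := by
  -- ### (1) the local classical Leray–Hopf solution and the datum
  obtain ⟨T₀, hT₀, v, q, hv, hv0, hvLH⟩ := local_classical_lerayHopf_holds ν hν u₀ hsm hdiv hdec
  have hvLH' : IsLerayHopfOn T₀ ν 0 (v 0) v := by rw [hv0]; exact hvLH
  have hdecv : HasRapidSpatialDecay (v 0) := by rw [hv0]; exact hdec
  have hu₀2 : MemLp u₀ 2 volume := by
    have h := hvLH.memLp 0 ⟨le_rfl, hT₀.le⟩
    rwa [hv0] at h
  have hdiv0 : IsWeaklyDivFree u₀ := hvLH.isWeaklyDivFree_datum hT₀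
  have hvK : IsKatoSolutionOn T₀ ν u₀ v := by
    have h := isKatoSolutionOn_of_classical hν hT₀ hv hvLH' hdecv
    rwa [hv0] at h
  have hu₀3 : MemLp u₀ 3 volume := hvK.memLp_initial hT₀
  have hvcont : ContinuousOn (uncurry v) (Ico 0 T₀ ×ˢ univ) := hv.smooth_velocity.continuousOn
  -- ### (2) Kato's maximal time
  by_contra htop
  set Tm : ℝ≥0∞ := katoMaximalTime ν u₀ with hTm_def
  have hT₀le : ENNReal.ofReal T₀ ≤ Tm := hvK.ofReal_le_katoMaximalTime
  have hTm_lt : Tm < ⊤ := lt_top_iff_ne_top.2 htop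
  have hTm_pos : 0 < Tm := lt_of_lt_of_le (ENNReal.ofReal_pos.2 hT₀) hT₀le
  set T : ℝ := Tm.toReal with hT_def
  have hTeq : ENNReal.ofReal T = Tm := ENNReal.ofReal_toReal htop
  have hT₀T : T₀ ≤ T := by
    have h : ENNReal.ofReal T₀ ≤ ENNReal.ofReal T := by rw [hTeq]; exact hT₀le
    exact (ENNReal.ofReal_le_ofReal_iff ENNReal.toReal_nonneg).1 h
  have hTpos : 0 < T := hT₀.trans_le hT₀T
  obtain ⟨κ, hκ⟩ := exists_isKatoSolutionOn_katoMaximalTime kato_unique_holds hν hTm_pos hTm_lt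
  have hmax : ∀ T' : ℝ, T < T' →
      ∀ z : ℝ → EuclideanSpace ℝ (Fin 3) → EuclideanSpace ℝ (Fin 3), ¬ IsKatoSolutionOn T' ν u₀ z :=
    fun T' hT' z => not_isKatoSolutionOn_of_katoMaximalTime_lt (by
      rw [← hTm_def, ← hTeq]
      exact (ENNReal.ofReal_lt_ofReal_iff (hTpos.trans hT')).2 hT')
  -- ### (3) the classical representative `U` of `κ` on `[0, T)`
  obtain ⟨w, ϖ, hw, hwκ⟩ := mild_L3_smooth_holds hν hTpos hu₀3 hdiv0 hκ.mild hκ.continuousInLpOn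
    hκ.aestronglyMeasurable
  have hvκ : ∀ t ∈ Ico 0 T₀, v t =ᵐ[volume] κ t := fun t ht =>
    IsKatoSolutionOn.ae_eq kato_unique_holds hν hvK hκ ht.1 ht.2 (ht.2.trans_le hT₀T)
  have hvw : ∀ t ∈ Ioo 0 T₀, v t = w t := by
    intro t ht
    have h1 : v t =ᵐ[volume] w t :=
      (hvκ t ⟨ht.1.le, ht.2⟩).trans (hwκ t ⟨ht.1, ht.2.trans_le hT₀T⟩).symm
    exact (Continuous.ae_eq_iff_eq volume (hv.contDiff_velocity ⟨ht.1.le, ht.2⟩).continuous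
      (hw.contDiff_velocity ⟨ht.1, ht.2.trans_le hT₀T⟩).continuous).1 h1
  have hU := hv.glue hw le_rfl hT₀ hT₀T hvw
  set U : ℝ → EuclideanSpace ℝ (Fin 3) → EuclideanSpace ℝ (Fin 3) :=
    fun t => if t < T₀ then v t else w t with hU_def
  set P : ℝ → EuclideanSpace ℝ (Fin 3) → ℝ :=
    fun t => if t < T₀ then (fun x => q t x - q t 0) else fun x => ϖ t x - ϖ t 0 with hP_def
  have hU0 : U 0 = u₀ := by simp only [hU_def, hT₀, if_true, hv0]
  have hUκ : ∀ t ∈ Ico 0 T, U t =ᵐ[volume] κ t := by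
    intro t ht
    by_cases htT₀ : t < T₀
    · simp only [hU_def, htT₀, if_true]
      exact hvκ t ⟨ht.1, htT₀⟩
    · simp only [hU_def, htT₀, if_false]
      exact hwκ t ⟨hT₀.trans_le (not_lt.1 htT₀), ht.2⟩
  have hUcont : ContinuousOn (uncurry U) (Ico 0 T ×ˢ univ) := hU.smooth_velocity.continuousOn
  have hUmeas : ∀ S : ℝ, S ≤ T →
      AEStronglyMeasurable (uncurry U) (volume.restrict (Ioo 0 S ×ˢ univ)) := fun S hS =>
    (hUcont.mono (prod_mono (Ioo_subset_Ico_self.trans (Ico_subset_Ico_right hS))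
      Subset.rfl)).aestronglyMeasurable (measurableSet_Ioo.prod MeasurableSet.univ)
  -- ### (4) Kato's smoothing bound, pointwise for `U`
  have hbound : ∀ S : ℝ, 0 < S → S < T → ∃ C : ℝ, 0 ≤ C ∧
      ∀ t ∈ Ioo 0 S, ∀ x, ‖U t x‖ ≤ C / Real.sqrt t := by
    intro S hS0 hST
    obtain ⟨C, hC⟩ := kato_solution_le_div_sqrt_holds ν T u₀ κ hν hκ S hS0 hST
    have hκS : AEStronglyMeasurable (uncurry κ) (volume.restrict (Ioo 0 S ×ˢ univ)) :=
      hκ.aestronglyMeasurable.mono_measure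
        (Measure.restrict_mono (prod_mono (Ioo_subset_Ioo_right hST.le) Subset.rfl) le_rfl)
    have hae : uncurry κ =ᵐ[volume.restrict (Ioo 0 S ×ˢ univ)] uncurry U :=
      ae_restrict_prod_of_forall_ae_eq (fun t ht => (hUκ t ⟨ht.1.le, ht.2.trans hST⟩).symm) hκS
        (hUmeas S hST.le)
    have hC' : ∀ᵐ z ∂(volume.restrict (Ioo 0 S ×ˢ (univ : Set (EuclideanSpace ℝ (Fin 3))))),
        ‖uncurry U z‖ ≤ |C| / Real.sqrt z.1 := by
      filter_upwards [hC, hae] with z hz hzU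
      calc ‖uncurry U z‖ = ‖κ z.1 z.2‖ := by rw [← hzU]; rfl
        _ ≤ C / Real.sqrt z.1 := hz
        _ ≤ |C| / Real.sqrt z.1 := by gcongr; exact le_abs_self C
    have hO : IsOpen (Ioo (0 : ℝ) S ×ˢ (univ : Set (EuclideanSpace ℝ (Fin 3)))) := isOpen_Ioo.prod isOpen_univ
    have hf : ContinuousOn (fun z : ℝ × EuclideanSpace ℝ (Fin 3) => ‖uncurry U z‖)
        (Ioo 0 S ×ˢ univ) :=
      (hUcont.mono (prod_mono (Ioo_subset_Ico_self.trans (Ico_subset_Ico_right hST.le))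
        Subset.rfl)).norm
    have hg : ContinuousOn (fun z : ℝ × EuclideanSpace ℝ (Fin 3) => |C| / Real.sqrt z.1)
        (Ioo 0 S ×ˢ univ) := by
      exact continuousOn_const.div (Real.continuous_sqrt.comp_continuousOn continuousOn_fst)
        fun z hz => (Real.sqrt_pos.2 hz.1.1).ne'
    exact ⟨|C|, abs_nonneg C, fun t ht x =>
      forall_le_of_ae_restrict_le_of_continuousOn hO hf hg hC' (t, x) ⟨ht, mem_univ x⟩⟩
  -- ### (5) the bound of `v` on `[0, T₀/2]` (Tao 2013, Cor. 11.1)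
  obtain ⟨M₁, hM₁⟩ := exists_forall_norm_le_of_tao2011 tao2011_hasBoundedSobolevNormsOn_holds hν hv
    hvLH' hdecv (T₀ / 2) ⟨half_pos hT₀, half_lt_self hT₀⟩
  -- ### (6) `κ` is Leray–Hopf on `[0, S']` and agrees with Leray's weak solution
  obtain ⟨uL, huL⟩ := leray_existence_R3_holds ν hν u₀ hu₀2 hdiv0
  have hLae : ∀ t ∈ Ioo 0 T, uL t =ᵐ[volume] U t := by
    intro t ht
    set S' : ℝ := (t + T) / 2 with hS'_def  -- horizons `t < S' < S < T`
    set S : ℝ := (S' + T) / 2 with hS_def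
    have htS' : t < S' := by rw [hS'_def]; linarith [ht.2]
    have hS'T : S' < T := by rw [hS'_def]; linarith [ht.2]
    have hS'0 : 0 < S' := ht.1.trans htS'
    have hS'S : S' < S := by rw [hS_def]; linarith
    have hST : S < T := by rw [hS_def]; linarith
    have hS0 : 0 < S := hS'0.trans hS'S
    obtain ⟨C, hC0, hC⟩ := hbound S hS0 hST
    -- Kato's smoothing hypothesis on `(0, S)` for `κ`
    have hinf : ∀ s ∈ Ioo 0 S, eLpNorm (κ s) ∞ volume ≤ ENNReal.ofReal (C / Real.sqrt s) := by
      intro s hs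
      rw [eLpNorm_congr_ae (hUκ s ⟨hs.1.le, hs.2.trans hST⟩).symm, eLpNorm_exponent_top]
      exact eLpNormEssSup_le_of_ae_bound (Eventually.of_forall fun x => hC s hs x)
    have hκLH : IsLerayHopfOn S' ν 0 u₀ κ :=
      ((hκ.mono hST.le).isLerayHopfOn_of_memLp_two hν hu₀2 hinf hS'S hS'0).1
    -- Serrin's class `L^∞(0, S'; L^∞)`
    set M : ℝ := max M₁ (C / Real.sqrt (T₀ / 2)) with hM_def
    have hUM : ∀ s ∈ Ioo 0 S', ∀ x, ‖U s x‖ ≤ M := by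
      intro s hs x
      by_cases hs2 : s ≤ T₀ / 2
      · have hsT₀ : s < T₀ := hs2.trans_lt (half_lt_self hT₀)
        have hUs : U s = v s := by simp only [hU_def, hsT₀, if_true]
        rw [hUs]
        exact (hM₁ s ⟨hs.1.le, hs2⟩ x).trans (le_max_left _ _)
      · push Not at hs2
        have h1 : ‖U s x‖ ≤ C / Real.sqrt s := hC s ⟨hs.1, hs.2.trans hS'S⟩ x
        have h2 : C / Real.sqrt s ≤ C / Real.sqrt (T₀ / 2) := by
          apply div_le_div_of_nonneg_left hC0 (Real.sqrt_pos.2 (half_pos hT₀))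
          exact Real.sqrt_le_sqrt hs2.le
        exact (h1.trans h2).trans (le_max_right _ _)
    have hSerrin : MemLqLp ∞ ∞ κ (Ioo 0 S') := by
      refine memLqLp_of_ae_eLpNorm_le (C := ENNReal.ofReal M) ENNReal.ofReal_ne_top ?_ ?_ ?_
      · rw [Real.volume_Ioo]; exact ENNReal.ofReal_ne_top
      · refine (ae_restrict_iff' measurableSet_Ioo).2 (Eventually.of_forall fun s hs => ?_)
        exact memLp_top_of_bound (hκ.memLp ⟨hs.1.le, hs.2.trans hS'T⟩).1 M
          ((hUκ s ⟨hs.1.le, hs.2.trans hS'T⟩).mono fun x hx => by rw [← hx]; exact hUM s hs x)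
      · refine (ae_restrict_iff' measurableSet_Ioo).2 (Eventually.of_forall fun s hs => ?_)
        rw [eLpNorm_congr_ae (hUκ s ⟨hs.1.le, hs.2.trans hS'T⟩).symm, eLpNorm_exponent_top]
        exact eLpNormEssSup_le_of_ae_bound (Eventually.of_forall fun x => hUM s hs x)
    -- weak–strong uniqueness on `[0, S']`
    have hqr : 2 / (∞ : ℝ≥0∞) + 3 / (∞ : ℝ≥0∞) ≤ 1 := by simp [ENNReal.div_top]
    exact (weak_strong_uniqueness_holds hν hS'0 hκLH ENNReal.ofNat_lt_top hqr hSerrin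
      (huL.isLerayHopfOn hS'0) t ⟨ht.1, htS'.le⟩).trans (hUκ t ⟨ht.1.le, ht.2⟩).symm
  -- ### (7) the velocity `Ũ`, Leray–Hopf on `[0, T]`
  set uL' : ℝ → EuclideanSpace ℝ (Fin 3) → EuclideanSpace ℝ (Fin 3) := Function.update uL 0 u₀
    with huL'_def
  have huL'LH : IsLerayHopfOn T ν 0 u₀ uL' := isLerayHopfOn_update_zero (huL.isLerayHopfOn hTpos) hu₀2
  set Ut : ℝ → EuclideanSpace ℝ (Fin 3) → EuclideanSpace ℝ (Fin 3) :=
    fun t => if t < T then U t else uL' t with hUt_def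
  have hUtU : ∀ t ∈ Ico 0 T, Ut t = U t := fun t ht => by simp only [hUt_def, ht.2, if_true]
  have hUtcl : IsClassicalNSSolutionOn (Ico 0 T) ν 0 Ut P := hU.congr_slices hUtU fun _ _ => rfl
  have hUt0 : Ut 0 = u₀ := by rw [hUtU 0 ⟨le_rfl, hTpos⟩, hU0]
  have hUtmeas : AEStronglyMeasurable (uncurry Ut) (volume.restrict (Ioo 0 T ×ˢ univ)) := by
    refine (hUmeas T le_rfl).congr ?_
    filter_upwards [ae_restrict_mem (measurableSet_Ioo.prod MeasurableSet.univ)] with z hz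
    change U z.1 z.2 = Ut z.1 z.2
    rw [hUtU z.1 ⟨hz.1.1.le, hz.1.2⟩]
  have hUtLH : IsLerayHopfOn T ν 0 u₀ Ut := by
    refine huL'LH.congr_ae_slices hTpos hUtmeas fun t ht => ?_
    by_cases htT : t < T
    · rw [hUtU t ⟨ht.1, htT⟩]
      rcases ht.1.eq_or_lt with h0 | h0
      · rw [← h0, hU0, huL'_def, Function.update_self]
      · rw [huL'_def, Function.update_of_ne h0.ne']
        exact (hLae t ⟨h0, htT⟩).symm
    · simp only [hUt_def, htT, if_false]
      exact EventuallyEq.rfl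
  have hUtLH' : IsLerayHopfOn T ν 0 (Ut 0) Ut := by rw [hUt0]; exact hUtLH
  have hdecUt : HasRapidSpatialDecay (Ut 0) := by rw [hUt0]; exact hdec
  -- ### (8) the classical continuation past `T`
  obtain ⟨T', hTT', W, Pr, hW, hWU⟩ := hNB ν T hν hTpos Ut P hUtcl hUtLH' hdecUt
  -- ### (9) `Ũ` is a Kato solution with maximal lifespan: a singular point `(T, x₀)`
  have hUtK : IsKatoSolutionOn T ν u₀ Ut := by
    have h := isKatoSolutionOn_of_classical hν hTpos hUtcl hUtLH' hdecUt
    rwa [hUt0] at h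
  obtain ⟨x₀, hx₀⟩ := lemarieRieusset_singular_point_of_blowup_holds hν hTpos hu₀3 hdiv0 hUtK hmax
  -- ### (10) `W` is bounded near `(T, x₀)`: contradiction
  set T'' : ℝ := (T + T') / 2 with hT''_def
  have hTT'' : T < T'' := by rw [hT''_def]; linarith
  have hT''T' : T'' < T' := by rw [hT''_def]; linarith
  set K : Set (ℝ × EuclideanSpace ℝ (Fin 3)) := Icc 0 T'' ×ˢ closedBall x₀ 1 with hK_def
  have hK : IsCompact K := isCompact_Icc.prod (isCompact_closedBall x₀ 1)
  have hKsub : K ⊆ Ico 0 T' ×ˢ univ := prod_mono (Icc_subset_Ico_right hT''T') (subset_univ _)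
  obtain ⟨M, hM⟩ := hK.exists_bound_of_continuousOn (hW.smooth_velocity.continuousOn.mono hKsub)
  set r : ℝ := min 1 (Real.sqrt T / 2) with hr_def
  have hsqT : 0 < Real.sqrt T := Real.sqrt_pos.2 hTpos
  have hr : 0 < r := lt_min one_pos (by positivity)
  have hr1 : r ≤ 1 := min_le_left _ _
  have hrT : r ^ 2 < T := by
    have h1 : r ≤ Real.sqrt T / 2 := min_le_right _ _
    have h2 : r ^ 2 ≤ (Real.sqrt T / 2) ^ 2 := pow_le_pow_left₀ hr.le h1 2
    have h3 : (Real.sqrt T / 2) ^ 2 = T / 4 := by rw [div_pow, Real.sq_sqrt hTpos.le]; norm_num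
    linarith
  have hQ : ∀ z ∈ parabolicCylinder r ((T : ℝ), x₀), z ∈ K ∧ z.1 ∈ Ico 0 T := by
    intro z hz
    rw [mem_parabolicCylinder] at hz
    obtain ⟨⟨hz1, hz2⟩, hz3⟩ := hz
    have hz0 : 0 ≤ z.1 := by linarith
    exact ⟨⟨⟨hz0, (le_of_lt hz2).trans hTT''.le⟩, mem_closedBall.2 ((le_of_lt hz3).trans hr1)⟩,
      hz0, hz2⟩
  have hbd : ∀ᵐ z ∂(volume.restrict (parabolicCylinder r ((T : ℝ), x₀))), ‖uncurry Ut z‖ ≤ M := by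
    filter_upwards [ae_restrict_mem (measurableSet_Ioo.prod measurableSet_ball)] with z hz
    obtain ⟨hzK, hzT⟩ := hQ z hz
    have h1 : uncurry Ut z = uncurry W z := by
      change Ut z.1 z.2 = W z.1 z.2
      rw [hWU z.1 hzT]
    rw [h1]
    exact hM z hzK
  exact (eLpNorm_exponent_top (f := uncurry Ut) ▸ eLpNormEssSup_lt_top_of_ae_bound hbd).ne
    (hx₀ r hr hrT)

/-- **Item stmt-NavierStokesRegularity-0055 (`NoBlowupToClay`): no blow-up of classical
Leray–Hopf solutions from rapidly decaying data implies Clay (A).** Given the no-blow-up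
hypothesis, Kato's maximal time of every Clay datum is infinite
(`katoMaximalTime_eq_top_of_noBlowup`), so the datum has a global Kato `C_t L³` solution
(`hasGlobalKatoSolution_of_katoMaximalTime_eq_top` with `kato_unique_holds`), and the proved fact
`clay_solution_of_hasGlobalKatoSolution_holds` (von Wahl; Lemarié-Rieusset 2016, Prop. 12.3 with
Thms. 7.2, 7.7; Kato 1984, Thm. 4) turns it into a pair `(u, p)` smooth on `ℝ³ × [0, ∞)` solving
the Navier–Stokes system from the datum with bounded energy — Fefferman's (A).
[cite: LemarieRieusset2016, Prop. 12.3 and Thm. 15.1] -/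
theorem noBlowupToClay_proof :
    Summit.NavierStokesRegularity.NavierStokesRegularity.Theses.SqueezeCycle.NoBlowupToClay := by
  unfold Summit.NavierStokesRegularity.NavierStokesRegularity.Theses.SqueezeCycle.NoBlowupToClay
  intro hNB ν hν u₀ hsm hdiv hdec
  have htop : katoMaximalTime ν u₀ = ⊤ := katoMaximalTime_eq_top_of_noBlowup hNB hν hsm hdiv hdec
  exact clay_solution_of_hasGlobalKatoSolution_holds ν hν u₀ hsm hdiv hdec
    (hasGlobalKatoSolution_of_katoMaximalTime_eq_top kato_unique_holds hν htop)

end Summit.NavierStokesRegularity.NavierStokesRegularity.Theorems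

end
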